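import Summits.NavierStokesRegularity.NavierStokesRegularity.Theorems.AxisymmetricExtremalityAxisymmetricKatoGlobalReduction
import Summits.NavierStokesRegularity.NavierStokesRegularity.Theorems.AxisymmetricExtremalityAxisymmetricKatoGlobalStubSereginLogSwirlOrigin
import Literature.Barriers.NavierStokesRegularity.ContinuityMethodClosedness
import Literature.Analysis.FluidPDE.KatoViscosityScaling
import Literature.Analysis.FluidPDE.EulerTimeScaling
import HarnessLib

/-!
# Strategist s19 — typed companions of `STRATEGY-CENSUS-s19.md`
(crux `AxisymmetricExtremality.AxisymmetricKatoGlobal`, stmt-NavierStokesRegularity-15453)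

Everything here ELABORATES; nothing is `sorry`d.  Open statements are `def … : Prop`; the
theorems are the assemblies / reductions the census relies on.

* §W  the weakest intermediate the route's `closes` actually consumes (`NoAxisymMinimalBlowupDatum`)
      with `w0_of_crux` and `closes_of_w0` (proved);
* §A  decomposition A = the registered line (criterion ∧ a-priori log³ modulus), assembly = the
      LANDED `Registered.AxisymmetricKatoGlobal_of_logSwirlFacts`;
* §B  decomposition B = the endpoint cut (ε-criterion ∧ qualitative axis vanishing), typed;
* §C  decomposition C = continuity in the data restricted to axisymmetric rays: PROVED equivalent to
      the crux (`axisymRayClosed_iff_crux`) — the catalogued barrier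
      `Literature.Barriers.NavierStokesRegularity.ContinuityMethodClosedness` instantiated;
* §S  strengthenings S⁺ (typed);
* §T  the transfer target from the no-swirl sibling (typed).
-/

noncomputable section

set_option linter.dupNamespace false

open Set MeasureTheory Filter Topology Function Metric
open scoped ENNReal NNReal
open Literature.Analysis.FluidPDE Literature.Analysis.FunctionSpaces
open Summit.NavierStokesRegularity.NavierStokesRegularity.Theses.AxisymmetricExtremality

namespace Summit.NavierStokesRegularity.NavierStokesRegularity.Cruxes.AxisymmetricKatoGlobal.StrategistS19

local notation "ℝ³" => EuclideanSpace ℝ (Fin 3)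
local notation "ℂ³" => EuclideanSpace ℂ (Fin 3)

/-! ## §W — the weakest intermediate consumed by `closes` -/

/-- **W0.** No `Ḣ^{1/2}`-minimal blow-up datum (Rusin–Šverák's set `M`, minimal over ALL data) is
axisymmetric about the `x₂`-axis.  This is literally the only instance of the crux that the route's
deciding theorem `closes` uses. -/
def NoAxisymMinimalBlowupDatum : Prop :=
  ∀ ν : ℝ, 0 < ν → ∀ (u₀ : ℝ³ → ℝ³) (g : HomSobolev ℝ³ ℂ³ (1 / 2 : ℝ)),
    IsMinimalBlowupDatum ν u₀ g → IsAxisymmetric u₀ → False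

/-- The crux implies W0 (trivial: a minimal blow-up datum has no global Kato solution). -/
theorem w0_of_crux (h : AxisymmetricKatoGlobal) : NoAxisymMinimalBlowupDatum := by
  intro ν hν u₀ g hmin hax
  obtain ⟨hL3, hrep, hdiv, -, hnot⟩ := hmin
  exact hnot (h ν hν u₀ g hL3 hrep hdiv (fun θ x => hax θ x))

/-- W0 suffices for the route: `closes` with the crux replaced by W0 (same pure-logic proof). -/
theorem closes_of_w0 (h₂ : MinimalDatumPFold) (h₄ : PFoldToAxisymmetric)
    (h₃ : NoAxisymMinimalBlowupDatum) : NavierStokesRegularity := by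
  show Literature.NS.NavierStokesExistenceSmoothR3
  intro ν hν u₀ hsm hdiv hdec
  by_contra hno
  obtain ⟨u₁, g, hmin, hax⟩ := h₄ ν hν (h₂ ν hν ⟨u₀, hsm, hdiv, hdec, hno⟩)
  exact h₃ ν hν u₁ g hmin (fun θ x => hax θ x)

/-- What minimality gives at such a datum, and all it gives: the norm identity and the absence of
a global Kato solution (the data-set compactness modulo `Sim` is `rusin_sverak_minimal_data_compact`).
Recorded to make the census's point checkable: no clause mentions the axis, the swirl, or any
a-priori quantity along the flow. -/
theorem minimal_datum_unpacked {ν : ℝ} {u₀ : ℝ³ → ℝ³} {g : HomSobolev ℝ³ ℂ³ (1 / 2 : ℝ)}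
    (h : IsMinimalBlowupDatum ν u₀ g) :
    ‖g‖ₑ = rusinSverakRhoMaxPure ν ∧ ¬ HasGlobalKatoSolution ν u₀ := ⟨h.2.2.2.1, h.2.2.2.2⟩

/-! ## §A — decomposition A (the registered line): criterion ∧ a-priori log³ axis modulus -/

/-- **A2 (open a-priori estimate; verbatim the registered stub `stub_swirlAxisModulus`).** -/
def SwirlAxisLogModulus : Prop :=
  ∀ ν : ℝ, 0 < ν → ∀ T : ℝ, 0 < T → ∀ (u₀ : ℝ³ → ℝ³) (g : HomSobolev ℝ³ ℂ³ (1 / 2 : ℝ))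
    (u : ℝ → ℝ³ → ℝ³), g.Represents (Literature.Analysis.FunctionSpaces.EuclideanSpace.complexify ∘ u₀) →
    IsKatoSolutionOn T ν u₀ u → ContDiffOn ℝ (⊤ : ℕ∞) (uncurry u) (Ioo 0 T ×ˢ univ) →
    (∀ t ∈ Ioo 0 T, IsAxisymmetric (u t)) → ∀ t₀ ∈ Ioo 0 T, ∃ C δ₀ : ℝ, 0 < δ₀ ∧ δ₀ < 1 ∧
      ∀ t ∈ Ico t₀ T, ∀ x : ℝ³, cylRadius x ≤ δ₀ → |swirl (u t) x| ≤ C / |Real.log (cylRadius x)| ^ 3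

/-- **Assembly A (LANDED, p150628).** A1 = Seregin 2022 §2 (published, named fact) and A2 give the crux. -/
theorem decompA : seregin2022_logSwirl_regularAtOrigin → SwirlAxisLogModulus → AxisymmetricKatoGlobal :=
  Theorems.AxisymmetricKatoGlobal.Registered.AxisymmetricKatoGlobal_of_logSwirlFacts

/-- **A1 is DISCHARGED in the tree** (`seregin2022_logSwirl_regularAtOrigin_holds`, stub 2a of the
registered skeleton, `…StubSereginLogSwirlOrigin.lean`), so the crux follows from the single open a-priori
estimate A2 — unconditionally, kernel-checked. -/
theorem crux_of_swirlAxisLogModulus : SwirlAxisLogModulus → AxisymmetricKatoGlobal :=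
  decompA Theorems.AxisymmetricKatoGlobal.EulerScaling.seregin2022_logSwirl_regularAtOrigin_holds

/-! ## §B — decomposition B (the endpoint cut): ε-criterion ∧ qualitative axis vanishing -/

/-- **B1 (open criterion: the endpoint `d = 1` of Chen–Fang–Zhang Thm 1.1 (2) / "lower the power on
|ln r| further", in Seregin's LOCAL frame).**  There is an absolute `ε > 0` such that an axisymmetric
suitable weak solution of Seregin's class Def. 1.1 in the unit cylinder whose swirl satisfies
`|σ| ≤ ε` is regular at the origin. -/
def AxisSwirlSmallnessCriterion : Prop :=
  ∃ ε : ℝ, 0 < ε ∧ ∀ (v : ℝ → ℝ³ → ℝ³) (q : ℝ → ℝ³ → ℝ),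
    IsSuitableWeakSolutionOn (SereginSverak2009.parCylOpens 0 1) 1 0 v q →
    (∃ C : ℝ≥0, ∀ᵐ t ∂(volume.restrict (Ioo (-1 : ℝ) 0)),
        ∫⁻ x in SereginSverak2009.spaceCyl 0 1, ‖v t x‖ₑ ^ 2 ≤ C) →
    (∃ G : ℝ → ℝ³ → ℝ³ →L[ℝ] ℝ³,
        HasWeakSpatialGradientOn (SereginSverak2009.parCylOpens 0 1) v G ∧
        ∫⁻ z in SereginSverak2009.parCyl 0 1, ENNReal.ofReal (frobeniusNormSq (G z.1 z.2)) < ∞) →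
    (∫⁻ z in SereginSverak2009.parCyl 0 1, ‖q z.1 z.2‖ₑ ^ (3 / 2 : ℝ) < ∞) →
    (∀ t ∈ Ioo (-1 : ℝ) 0, IsAxisymmetric (v t)) →
    (∀ t ∈ Ioo (-1 : ℝ) 0, IsAxisymmetricScalar (q t)) →
    (∀ t ∈ Ioo (-1 : ℝ) 0, ∀ x ∈ SereginSverak2009.spaceCyl 0 1, |swirl (v t) x| ≤ ε) →
    SereginSverak2009.IsRegularAtOrigin v

/-- **B2 (open a-priori statement, qualitative).** Along an axisymmetric Kato solution on `[0,T)`,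
smooth inside, the swirl tends to `0` at the axis UNIFORMLY in time up to `T`:
`∀ ε > 0 ∃ t₀ < T ∃ δ₀ > 0, |Γ(t,x)| ≤ ε` for `t ∈ [t₀,T)`, `cylRadius x ≤ δ₀`.
(Trivially true on every `[t₀, T']`, `T' < T`; the content is at `t → T`.) -/
def AxisSwirlUniformVanishing : Prop :=
  ∀ ν : ℝ, 0 < ν → ∀ T : ℝ, 0 < T → ∀ (u₀ : ℝ³ → ℝ³) (g : HomSobolev ℝ³ ℂ³ (1 / 2 : ℝ))
    (u : ℝ → ℝ³ → ℝ³), g.Represents (Literature.Analysis.FunctionSpaces.EuclideanSpace.complexify ∘ u₀) →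
    IsKatoSolutionOn T ν u₀ u → ContDiffOn ℝ (⊤ : ℕ∞) (uncurry u) (Ioo 0 T ×ˢ univ) →
    (∀ t ∈ Ioo 0 T, IsAxisymmetric (u t)) →
    ∀ ε : ℝ, 0 < ε → ∃ t₀ ∈ Ioo 0 T, ∃ δ₀ : ℝ, 0 < δ₀ ∧
      ∀ t ∈ Ico t₀ T, ∀ x : ℝ³, cylRadius x ≤ δ₀ → |swirl (u t) x| ≤ ε

/-- **Assembly B (typed, NOT proved here).** It is the re-run of the landed stubs 2c'
(`stub_axisBounded_of_localEnergy_origin`, p148895) and of the capstone (p150628) with the log³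
criterion hypothesis replaced by B1 and the log³ modulus by B2 — the rescaling step only gets
easier because `|σ| ≤ ε` is exactly scale invariant. -/
def DecompB_Assembly : Prop :=
  AxisSwirlSmallnessCriterion → AxisSwirlUniformVanishing → AxisymmetricKatoGlobal

/-- B1 implies the "any modulus" criterion: a modulus `ω` with `ω r ≤ ε` for `r ≤ α` puts the
solution, after restricting to `r ≤ α`, under B1's hypothesis.  Recorded as the elementary real
inequality that does the work (the PDE bookkeeping is the rescaling of Assembly B). -/
theorem small_of_modulus {ω : ℝ → ℝ} {ε α : ℝ} (hω : ∀ r, r ≤ α → ω r ≤ ε) {Γ r : ℝ}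
    (hΓ : |Γ| ≤ ω r) (hr : r ≤ α) : |Γ| ≤ ε := hΓ.trans (hω r hr)

/-! ## §C — decomposition C: continuity in the data along axisymmetric rays (barrier instance) -/

/-- **C (closedness of the good set along axisymmetric rays).** For every axisymmetric critical datum
`u₀` the set of amplitudes `s` for which `s • u₀` has a global Kato solution is closed. -/
def AxisymRayClosed : Prop :=
  ∀ ν : ℝ, 0 < ν → ∀ (u₀ : ℝ³ → ℝ³) (g : HomSobolev ℝ³ ℂ³ (1 / 2 : ℝ)), MemLp u₀ 3 volume →
    g.Represents (Literature.Analysis.FunctionSpaces.EuclideanSpace.complexify ∘ u₀) → IsWeaklyDivFree u₀ →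
    IsAxisymmetric u₀ → IsClosed {s : ℝ | HasGlobalKatoSolution ν (s • u₀)}

/-- Amplitude rescaling preserves axisymmetry (pointwise form of `IsAxisymmetric.const_smul`). -/
theorem isAxisymmetric_smul {u₀ : ℝ³ → ℝ³} (h : IsAxisymmetric u₀) (s : ℝ) :
    IsAxisymmetric (s • u₀) := fun θ x => by
  simp only [Pi.smul_apply, h θ x, rotZ_smul]

/-- **C is EQUIVALENT to the crux** — the catalogued barrier
`Literature.Barriers.NavierStokesRegularity.ContinuityMethodClosedness` (openness is GIP 2003, `0`
is good by Kato, `ℝ` is connected) restricted to axisymmetric rays, which are again axisymmetric.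
So "induct / continue in the swirl or data amplitude" re-partitions nothing: its closed step is the
crux itself. -/
theorem axisymRayClosed_iff_crux : AxisymRayClosed ↔ AxisymmetricKatoGlobal := by
  constructor
  · intro h ν hν u₀ g hL3 hrep hdiv hax
    exact Literature.Barriers.NavierStokesRegularity.hasGlobalKatoSolution_of_isClosed_ray hν hL3 hdiv
      (h ν hν u₀ g hL3 hrep hdiv (fun θ x => hax θ x))
  · intro h ν hν u₀ g hL3 hrep hdiv hax
    have : {s : ℝ | HasGlobalKatoSolution ν (s • u₀)} = univ := by
      refine eq_univ_of_forall fun s => ?_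
      have hax' : IsAxisymmetric (s • u₀) := isAxisymmetric_smul hax s
      exact h ν hν (s • u₀) (((s : ℝ) : ℂ) • g) (hL3.const_smul s) (represents_complexify_smul hrep s)
        (hdiv.const_smul s) (fun θ x => hax' θ x)
    rw [this]
    exact isClosed_univ

/-! ## §S — strengthenings S⁺ (typed) -/

/-- **S⁺₁ (uniform a-priori modulus, local, all suitable weak axisymmetric solutions).**  The swirl
of every axisymmetric suitable weak solution of Seregin's class in the unit cylinder has a
logarithmic modulus at the axis on the half cylinder with a UNIVERSAL profile: `|σ| ≤ C/|log r|³`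
for `r ≤ δ₀` on `Q(1/2)`, `C` depending on the solution.  Local, rescalable, compactness-friendly —
and exactly what De Giorgi–Nash–Moser delivers only under Type-I / slightly supercritical drift. -/
def LocalSwirlAxisModulus : Prop :=
  ∀ (v : ℝ → ℝ³ → ℝ³) (q : ℝ → ℝ³ → ℝ),
    IsSuitableWeakSolutionOn (SereginSverak2009.parCylOpens 0 1) 1 0 v q →
    (∃ C : ℝ≥0, ∀ᵐ t ∂(volume.restrict (Ioo (-1 : ℝ) 0)),
        ∫⁻ x in SereginSverak2009.spaceCyl 0 1, ‖v t x‖ₑ ^ 2 ≤ C) →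
    (∃ G : ℝ → ℝ³ → ℝ³ →L[ℝ] ℝ³,
        HasWeakSpatialGradientOn (SereginSverak2009.parCylOpens 0 1) v G ∧
        ∫⁻ z in SereginSverak2009.parCyl 0 1, ENNReal.ofReal (frobeniusNormSq (G z.1 z.2)) < ∞) →
    (∫⁻ z in SereginSverak2009.parCyl 0 1, ‖q z.1 z.2‖ₑ ^ (3 / 2 : ℝ) < ∞) →
    (∀ t ∈ Ioo (-1 : ℝ) 0, IsAxisymmetric (v t)) →
    (∀ t ∈ Ioo (-1 : ℝ) 0, IsAxisymmetricScalar (q t)) →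
    ∃ C δ₀ : ℝ, 0 < δ₀ ∧ δ₀ < 1 ∧ ∀ t ∈ Ioo (-(1 / 4 : ℝ)) 0, ∀ x ∈ SereginSverak2009.spaceCyl 0 (1 / 2),
      0 < cylRadius x → cylRadius x ≤ δ₀ → |swirl (v t) x| ≤ C / |Real.log (cylRadius x)| ^ 3

/-- **S⁺₂ (local axisymmetric regularity, Seregin's formulation of the whole problem).** Every
axisymmetric suitable weak solution of Seregin's class Def. 1.1/1.3 in the unit cylinder is regular at
the origin (its swirl is automatically essentially bounded on `Q(1/2)`: `swirl_ae_bounded_half`,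
PROVED).  The crux follows from it by the landed stubs 1, K, 2b', 2c' with the modulus hypothesis
deleted; it is the named open problem "axisymmetric regularity with swirl", local form. -/
def LocalAxisymRegularity : Prop :=
  ∀ (v : ℝ → ℝ³ → ℝ³) (q : ℝ → ℝ³ → ℝ),
    IsSuitableWeakSolutionOn (SereginSverak2009.parCylOpens 0 1) 1 0 v q →
    (∃ C : ℝ≥0, ∀ᵐ t ∂(volume.restrict (Ioo (-1 : ℝ) 0)),
        ∫⁻ x in SereginSverak2009.spaceCyl 0 1, ‖v t x‖ₑ ^ 2 ≤ C) →
    (∃ G : ℝ → ℝ³ → ℝ³ →L[ℝ] ℝ³,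
        HasWeakSpatialGradientOn (SereginSverak2009.parCylOpens 0 1) v G ∧
        ∫⁻ z in SereginSverak2009.parCyl 0 1, ENNReal.ofReal (frobeniusNormSq (G z.1 z.2)) < ∞) →
    (∫⁻ z in SereginSverak2009.parCyl 0 1, ‖q z.1 z.2‖ₑ ^ (3 / 2 : ℝ) < ∞) →
    (∀ t ∈ Ioo (-1 : ℝ) 0, IsAxisymmetric (v t)) →
    (∀ t ∈ Ioo (-1 : ℝ) 0, IsAxisymmetricScalar (q t)) →
    SereginSverak2009.IsRegularAtOrigin v

/-- S⁺₁ feeds the registered criterion: with Seregin 2022 §2 it gives S⁺₂ outright (one line). -/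
theorem localAxisymRegularity_of (h2a : seregin2022_logSwirl_regularAtOrigin)
    (hS : ∀ (v : ℝ → ℝ³ → ℝ³) (q : ℝ → ℝ³ → ℝ),
      IsSuitableWeakSolutionOn (SereginSverak2009.parCylOpens 0 1) 1 0 v q →
      (∃ C : ℝ≥0, ∀ᵐ t ∂(volume.restrict (Ioo (-1 : ℝ) 0)),
          ∫⁻ x in SereginSverak2009.spaceCyl 0 1, ‖v t x‖ₑ ^ 2 ≤ C) →
      (∃ G : ℝ → ℝ³ → ℝ³ →L[ℝ] ℝ³,
          HasWeakSpatialGradientOn (SereginSverak2009.parCylOpens 0 1) v G ∧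
          ∫⁻ z in SereginSverak2009.parCyl 0 1, ENNReal.ofReal (frobeniusNormSq (G z.1 z.2)) < ∞) →
      (∫⁻ z in SereginSverak2009.parCyl 0 1, ‖q z.1 z.2‖ₑ ^ (3 / 2 : ℝ) < ∞) →
      (∀ t ∈ Ioo (-1 : ℝ) 0, IsAxisymmetric (v t)) →
      (∀ t ∈ Ioo (-1 : ℝ) 0, IsAxisymmetricScalar (q t)) →
      ∃ C₁ : ℝ, ∀ t ∈ Ioo (-1 : ℝ) 0, ∀ x ∈ SereginSverak2009.spaceCyl 0 1, 0 < cylRadius x →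
        |swirl (v t) x| ≤ C₁ / Real.log (Real.exp 1 / cylRadius x) ^ 3) :
    LocalAxisymRegularity := by
  intro v q hsw hA hG hq hax hqax
  exact h2a v q hsw hA hG hq hax hqax (hS v q hsw hA hG hq hax hqax)

/-! ## §T — transfer target from the no-swirl sibling (typed) -/

/-- **T (the step of the no-swirl proof that does not transfer).**  In Ukhovskii–Yudovich /
Ladyzhenskaya 1968 the quantity `ω_θ / r` obeys a drift–diffusion equation WITHOUT source and all its
`L^p` norms are non-increasing; with swirl the same equation carries the source `∂_z (Γ²) / r⁴`.
The transferred statement would be an a-priori bound of the enstrophy-type quantity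
`sup_t ‖ω_θ/r‖_{L²}` along axisymmetric classical solutions in terms of the data — typed here in the
simplest global form over the tree's continuation frame (`ν = 1`). Open; equivalent in strength to
regularity by the CKN/Prodi–Serrin-type criteria (`ChenFangZhang2017_verticalVorticity_regularity` &c.). -/
def SwirlSourceControlled : Prop :=
  ∀ (T : ℝ) (u : ℝ → ℝ³ → ℝ³) (p : ℝ → ℝ³ → ℝ), 0 < T →
    IsClassicalNSSolutionOn (Ico 0 T) 1 0 u p → IsLerayHopfOn T 1 0 (u 0) u →
    HasRapidSpatialDecay (u 0) → (∀ t ∈ Ico 0 T, IsAxisymmetric (u t)) →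
    ∃ M : ℝ, ∀ t ∈ Ico 0 T, ∀ x : ℝ³, 0 < cylRadius x → |swirl (u t) x| ≤ M * cylRadius x ^ 2

end Summit.NavierStokesRegularity.NavierStokesRegularity.Cruxes.AxisymmetricKatoGlobal.StrategistS19

end
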